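import Summits.NavierStokesRegularity.NavierStokesRegularity.Theorems.PlanarFluxAPriori.Negative.SlabApexBoundFalseKinematic

/-!
# Apex foam, part 4: the functional is infinite already on `B(0,2) ∩ {|x₂| < h}` — every LOCALISATION of
  `stub_slabApexBound` inherits the kinematic / `t₀ = 0` falsity (negative-side support for the crux
  `SlicedKelvin.PlanarFluxAPriori`, stmt-NavierStokesRegularity-15600, lines `Sketch` and `local-far`)

Refuter cdisprove seat g2, cycle 1 (2026-08-17). Part 3 (`…FalseKinematic.lean`) proved `liminf_{ε→0⁺} = ⊤` for the apex
functional of the witness on the full slab `{|x₂| < h}`. The crux strategist's line `local-far` (Lines/local-far.md) splits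
the stub at a radius `ρ` into a far part and `stub_apexLocalBound` (`∀ ρ, ∃ M h, liminf_ε ∫_{S_h(c) ∩ B_ρ} … ≤ M`). This file
records the sharper fact behind part 3: the minorant of the proof is supported in the box `Kset h' ⊆ B(0,2) ∩ {|x₂| < h}`, so

* `ApexFoam.liminf_apex_eq_top_of_subset` — for EVERY set `A ⊇ B(0,2) ∩ {|x₂| < h}` the functional restricted to `A` has
  `liminf_{ε→0⁺} = ⊤` (in particular `A = S_h(0) ∩ B_ρ` for every `ρ ≥ 2`, and `A = S_h(0)`);
* `ApexFoam.exists_foamProfile` — the sign-alternating profile, factored out of part 3's witness;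
* `ApexFoam.apexFoam_witness_local` — the witness statement in this localised form (frame `R = 1`, height `0`).

Consequence: the kinematic form and the `t₀ = 0` form of ANY localisation `∫_{S_h(c) ∩ B_ρ}` (`ρ ≥ 2`; by scaling the foam,
any `ρ > 0`) of the stub are false exactly as in part 3 — the split at a radius moves no difficulty out of `stub_apexLocalBound`.
-/

noncomputable section

-- Problem = summit for this single-conjunct summit: the duplicate namespace component is deliberate.
set_option linter.dupNamespace false

namespace Summit.NavierStokesRegularity.NavierStokesRegularity.Theorems.PlanarFluxAPriori.Negative.ApexFoam

open MeasureTheory Set Function Filter Topology Literature.Analysis.FluidPDE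
open scoped ENNReal InnerProductSpace RealInnerProductSpace ContDiff

local notation "E3" => EuclideanSpace ℝ (Fin 3)
local notation "E2" => EuclideanSpace ℝ (Fin 2)

variable {g : ℝ → ℝ}

/-- The box lies in `B(0,2) ∩ {|x₂| < h}` once `0 < h' ≤ min h 1`. -/
theorem Kset_subset_ball_inter_slab {h h' : ℝ} (hh' : 0 < h') (hh'h : h' ≤ h) (hh'1 : h' ≤ 1) :
    Kset h' ⊆ Metric.ball (0 : E3) 2 ∩ {x : E3 | |⟪x, e 2⟫ - 0| < h} := fun x hx =>
  ⟨Kset_subset_ball hh' hh'1 hx, by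
    have h2 : |x 2| < h' := abs_two_lt_of_mem_Kset hh' hx
    simp only [mem_setOf_eq, e, EuclideanSpace.inner_single_right, sub_zero]
    simpa using h2.trans_le hh'h⟩

/-- **Main estimate, localised.** For a smooth compactly supported profile with `g(zₖ) = 0 ≠ g(mₖ)` and EVERY set
`A ⊇ B(0,2) ∩ {|x₂| < h}`, the apex functional of the witness restricted to `A` has `liminf_{ε→0⁺} = ⊤`. -/
theorem liminf_apex_eq_top_of_subset (hg : ContDiff ℝ ∞ g) (hgc : HasCompactSupport g) (hz : ∀ k, g (za k) = 0)
    (hm : ∀ k, g (zm k) ≠ 0) {h : ℝ} (hh : 0 < h) {A : Set E3}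
    (hA : Metric.ball (0 : E3) 2 ∩ {x : E3 | |⟪x, e 2⟫ - 0| < h} ⊆ A) :
    Filter.liminf (fun ε : ℝ => ∫⁻ x in A, G g ε x) (𝓝[>] 0) = ⊤ := by
  obtain ⟨C', hC'⟩ := exists_bound_deriv hg hgc
  have hC0 : 0 ≤ C' := (abs_nonneg _).trans (hC' 0)
  set h' : ℝ := min (min h 1) (1 / (2 * (C' + 1))) with hh'def
  have hh'pos : 0 < h' := lt_min (lt_min hh one_pos) (by positivity)
  have hh'h : h' ≤ h := (min_le_left _ _).trans (min_le_left _ _)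
  have hh'1 : h' ≤ 1 := (min_le_left _ _).trans (min_le_right _ _)
  have hh'C : 2 * h' * C' ≤ 1 := by
    have h1 : h' ≤ 1 / (2 * (C' + 1)) := min_le_right _ _
    rw [le_div_iff₀ (by positivity)] at h1
    nlinarith
  have hg1 : ContDiff ℝ 1 g := hg.of_le (by norm_cast)
  set V : ℝ≥0∞ := volume (Metric.ball (0 : E2) h') with hV
  have hVpos : V ≠ 0 := (Metric.measure_ball_pos volume (0 : E2) hh'pos).ne'
  have hK : ∀ K : ℕ, V * ((K : ℝ≥0∞) * ENNReal.ofReal (1 / 4)) ≤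
      Filter.liminf (fun ε : ℝ => ∫⁻ x in A, G g ε x) (𝓝[>] 0) := by
    intro K
    have hev : ∀ᶠ ε in 𝓝[>] (0 : ℝ), 0 < ε ∧ ∀ k ∈ Finset.range K, ε ≤ |g (zm k)| := by
      refine (eventually_mem_nhdsWithin).and ?_
      rw [Filter.eventually_all_finset]
      intro k _
      exact mem_nhdsWithin_of_mem_nhds (Iic_mem_nhds (abs_pos.2 (hm k)))
    refine le_liminf_of_le (by isBoundedDefault) ?_
    filter_upwards [hev] with ε ⟨hε, hεK⟩
    have hterm : ∀ k ∈ Finset.range K, ENNReal.ofReal (1 / 4) ≤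
        ∫⁻ s in Ioc (za k) (zm k), ENNReal.ofReal (apexDensity ε g s / 2) := by
      intro k hk
      refine le_trans ?_ (ofReal_abs_Hreg_le_lintegral hε.ne' hg1 (za_lt_zm k).le (hz k))
      refine ENNReal.ofReal_le_ofReal ?_
      have := half_le_Hreg hε (hεK k hk)
      rw [← abs_Hreg] at this
      linarith
    have hsuppε : support (Θ g ε h') ⊆ A :=
      (support_indicator_subset).trans ((Kset_subset_ball_inter_slab hh'pos hh'h hh'1).trans hA)
    calc V * ((K : ℝ≥0∞) * ENNReal.ofReal (1 / 4))
        = V * ∑ k ∈ Finset.range K, ENNReal.ofReal (1 / 4) := by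
          rw [Finset.sum_const, Finset.card_range, nsmul_eq_mul]
      _ ≤ V * ∑ k ∈ Finset.range K, ∫⁻ s in Ioc (za k) (zm k), ENNReal.ofReal (apexDensity ε g s / 2) := by
          gcongr with k hk
          exact hterm k hk
      _ ≤ V * ∫⁻ s in Icc (0 : ℝ) 1, ENNReal.ofReal (apexDensity ε g s / 2) := by
          gcongr
          exact sum_lintegral_le_lintegral_Icc _ K
      _ = ∫⁻ x, Θ g ε h' x := (lintegral_Θ hg ε hh'pos).symm
      _ = ∫⁻ x in A, Θ g ε h' x := (setLIntegral_eq_of_support_subset hsuppε).symm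
      _ ≤ ∫⁻ x in A, G g ε x := lintegral_mono (Θ_le_G hg hC' hh'pos hh'1 hh'C ε)
  have hc : V * ENNReal.ofReal (1 / 4) ≠ 0 := mul_ne_zero hVpos (by simp)
  rw [eq_top_iff]
  calc (⊤ : ℝ≥0∞) = V * ENNReal.ofReal (1 / 4) * ⊤ := (ENNReal.mul_top hc).symm
    _ = V * ENNReal.ofReal (1 / 4) * ⨆ K : ℕ, (K : ℝ≥0∞) := by rw [ENNReal.iSup_natCast]
    _ = ⨆ K : ℕ, V * ENNReal.ofReal (1 / 4) * (K : ℝ≥0∞) := ENNReal.mul_iSup _ _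
    _ ≤ _ := iSup_le fun K => by
        calc V * ENNReal.ofReal (1 / 4) * (K : ℝ≥0∞) = V * ((K : ℝ≥0∞) * ENNReal.ofReal (1 / 4)) := by ring
          _ ≤ _ := hK K

/-- **The sign-alternating foam profile** (factored out of part 3's witness): a smooth compactly supported `g` with
`g(zₖ) = 0` and `g(mₖ) ≠ 0` for all `k` (`g = g₊ − g₋`, supports `⋃ᵢ (z₂ᵢ₊ᵣ, b₂ᵢ₊ᵣ)`, `r = 0, 1`). -/
theorem exists_foamProfile :
    ∃ g : ℝ → ℝ, ContDiff ℝ ∞ g ∧ HasCompactSupport g ∧ (∀ k, g (za k) = 0) ∧ ∀ k, g (zm k) ≠ 0 := by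
  set W : ℕ → Set ℝ := fun r => ⋃ i : ℕ, Ioo (za (2 * i + r)) (zb (2 * i + r)) with hW
  have hWo : ∀ r, IsOpen (W r) := fun r => isOpen_iUnion fun _ => isOpen_Ioo
  have hWU : ∀ r, W r ⊆ Icc 0 1 := fun r s hs => by
    obtain ⟨i, hi⟩ := mem_iUnion.1 hs
    have hU := U_subset (mem_iUnion.2 ⟨2 * i + r, hi⟩)
    exact ⟨hU.1.le, hU.2.trans (by norm_num)⟩
  obtain ⟨gp, hgps, hgp, -⟩ := (hWo 0).exists_contDiff_support_eq (n := ⊤)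
  obtain ⟨gn, hgns, hgn, -⟩ := (hWo 1).exists_contDiff_support_eq (n := ⊤)
  have hcs : ∀ {f : ℝ → ℝ} {r : ℕ}, f.support = W r → HasCompactSupport f := fun {f r} hf =>
    HasCompactSupport.intro (isCompact_Icc (a := (0 : ℝ)) (b := 1)) fun s hs => by
      by_contra h
      exact hs (hWU r (hf ▸ (mem_support.2 h)))
  have hza : ∀ {f : ℝ → ℝ} {r : ℕ}, f.support = W r → ∀ k, f (za k) = 0 := fun {f r} hf k => by
    rw [← notMem_support, hf]
    intro hk
    obtain ⟨i, hi⟩ := mem_iUnion.1 hk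
    exact za_not_mem_U k (mem_iUnion.2 ⟨_, hi⟩)
  have hzm0 : ∀ {f : ℝ → ℝ} (r : ℕ), r ≤ 1 → f.support = W r → ∀ i, f (zm (2 * i + (1 - r))) = 0 := by
    intro f r hr hf i
    rw [← notMem_support, hf]
    intro hk
    obtain ⟨i', hi'⟩ := mem_iUnion.1 hk
    exact zm_not_mem_Ioo (by omega) hi'
  have hzm1 : ∀ {f : ℝ → ℝ} {r : ℕ}, f.support = W r → ∀ i, f (zm (2 * i + r)) ≠ 0 := by
    intro f r hf i
    rw [← mem_support, hf]
    exact mem_iUnion.2 ⟨i, za_lt_zm _, zm_lt_zb _⟩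
  refine ⟨fun s => gp s - gn s, hgp.sub hgn, (hcs hgps).sub (hcs hgns),
    fun k => by simp [hza hgps k, hza hgns k], fun k => ?_⟩
  obtain ⟨i, rfl | rfl⟩ := Nat.even_or_odd' k
  · have h1 := hzm1 hgps i
    have h2 := hzm0 1 le_rfl hgns i
    simp only [add_zero, Nat.sub_self] at h1 h2
    simpa [h2] using h1
  · have h1 := hzm1 hgns i
    have h2 := hzm0 0 (Nat.zero_le 1) hgps i
    simp only [Nat.sub_zero] at h2
    simp [h2, h1]

/-- **The witness, localised form.** A smooth, compactly supported, divergence-free, rapidly decaying field on `ℝ³` whose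
ε-apex functional restricted to ANY set `A ⊇ B(0,2) ∩ {|x₂| < h}` has `liminf_{ε→0⁺} = ⊤` (frame `R = 1`, height `0`; e.g.
`A = {|x₂| < h} ∩ B(0,ρ)`, `ρ ≥ 2`). [folklore] -/
theorem apexFoam_witness_local :
    ∃ v : E3 → E3, ContDiff ℝ (⊤ : ℕ∞) v ∧ HasCompactSupport v ∧ VectorCalculus.IsDivFree v ∧
      HasRapidSpatialDecay v ∧
      (∃ C : ℝ, ∀ (x : E3) (k : ℕ), k ≤ 3 → (1 + ‖x‖) ^ 3 * ‖iteratedFDeriv ℝ k v x‖ ≤ C) ∧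
      ∀ h : ℝ, 0 < h → ∀ A : Set E3,
        Metric.ball (0 : E3) 2 ∩ {x : E3 |
            |inner ℝ x ((LinearIsometryEquiv.refl ℝ E3) (EuclideanSpace.single 2 1)) - 0| < h} ⊆ A →
        Filter.liminf (fun ε : ℝ => ∫⁻ x in A,
          ENNReal.ofReal (ε ^ 2 / Real.sqrt (inner ℝ (curl v x)
            ((LinearIsometryEquiv.refl ℝ E3) (EuclideanSpace.single 2 1)) ^ 2 + ε ^ 2) ^ 3 *
            |fderiv ℝ (fun z => inner ℝ (curl v z) ((LinearIsometryEquiv.refl ℝ E3)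
              (EuclideanSpace.single 2 1))) x (curl v x)|)) (nhdsWithin 0 (Set.Ioi 0)) = ⊤ := by
  obtain ⟨g, hg, hgc, hz, hm⟩ := exists_foamProfile
  refine ⟨vfield g, contDiff_vfield hg, hasCompactSupport_vfield, isDivFree_vfield hg,
    hasRapidSpatialDecay_vfield hg, cubicDecay_vfield hg, fun h hh A hA => ?_⟩
  exact liminf_apex_eq_top_of_subset hg hgc hz hm hh hA

end Summit.NavierStokesRegularity.NavierStokesRegularity.Theorems.PlanarFluxAPriori.Negative.ApexFoam

end
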